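import Literature.AlgebraicGeometry.Crystalline.DeRhamComplexSheaf
import Literature.AlgebraicGeometry.Motives.GrothendieckVanishingProofs
import Literature.Algebra.Homology.HyperExt
import Literature.Algebra.Homology.StupidFiltration
import Literature.AlgebraicGeometry.Motives.CrystallineRealization
import HarnessLib

/-!
# Degeneration of the Hodge–de Rham spectral sequence modulo torsion for smooth proper `𝒳/W(k)`

For a field `k` of characteristic `p`, `W = W(k)` and `𝒳 → Spec W` smooth and proper, the Hodge–de
Rham spectral sequence `E₁^{a,b} = H^b(𝒳, Ωᵃ_{𝒳/W}) ⇒ H^{a+b}_{dR}(𝒳/W)` DEGENERATES AT `E₁` AFTER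
TENSORING WITH `K = W[1/p]` ("degeneration modulo torsion"): this is Deligne's theorem for the smooth
proper generic fibre `X_K → Spec K` over the characteristic-`0` field `K` (P. Deligne, *Théorème de
Lefschetz et critères de dégénérescence de suites spectrales*, Publ. IHÉS 35 (1968), Thm. 5.5 (ii):
for `f : X → S` proper and smooth with `S` of characteristic `0`, the spectral sequence
`R^q f_* Ω^p_{X/S} ⇒ R^{p+q} f_*(Ω•_{X/S})` degenerates — and (i): the `R^q f_*Ω^p` are locally free of
formation compatible with every base change), transported to `𝒳/W` by flat base change of coherent
cohomology along `W → K` (R. Hartshorne, *Algebraic Geometry*, III.9.3), which identifies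
`H^b(𝒳, Ωᵃ_{𝒳/W}) ⊗_W K ≅ H^b(X_K, Ωᵃ_{X_K/K})` compatibly with the maps induced by the de Rham
differentials. In exactly this form it is invoked by S. Bloch, H. Esnault, M. Kerz, *p-adic
deformation of algebraic cycle classes*, Invent. Math. 195 (2014), Remarks 8.x (1) (arXiv:1203.2776
"Remarks 35 (1)": "By the degeneration of the Hodge–de Rham spectral sequence modulo torsion, the map
`H^{2r}_cont(X_1, Ω^{≥r}_{X.}) ⊗ ℚ → H^{2r}_cont(X_1, Ω•_{X.}) ⊗ ℚ` is injective"). Integrally — all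
differentials vanish, with no torsion hypothesis — it holds in the range `a + min(b, d) ≤ p − 2`
(G. Faltings, *Crystalline cohomology and p-adic Galois representations*, in: Algebraic analysis,
geometry and number theory (1989), Thm. 4.1 with `E = 𝒪_X`; Fontaine–Messing 1987 and Kato 1987 for
`dim < p`).

## The statement recorded (`HodgeDeRhamDegeneratesModTorsion`)

We record the degeneration in the spectral-sequence-free language of the tree: with
`Ω• = Crystalline.algebraicDeRhamComplex 𝒳` (the algebraic de Rham complex of sheaves of abelian
groups on `|𝒳|`, `Crystalline/DeRhamComplexSheaf`, extended by zero to a `ℤ`-indexed complex) and its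
STUPID (Hodge) filtration `σ≤n Ω•` (`Literature.Algebra.Homology.stupidTruncLE`), the short exact
sequences of complexes `0 → Ωⁿ¹[−n₁] → σ≤n₁ Ω• → σ≤n₀ Ω• → 0` (`n₀ + 1 = n₁`;
`Literature.Algebra.Homology.stupidFiltrationShortComplex`, `shortExact_stupidFiltrationShortComplex`)
have connecting homomorphisms in hypercohomology
`δ : ℍ^{k₀}(𝒳, σ≤n₀ Ω•) → ℍ^{k₁}(𝒳, Ωⁿ¹[−n₁]) = H^{k₁−n₁}(𝒳, Ωⁿ¹)` (`k₀ + 1 = k₁`;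
`Literature.Algebra.Homology.HyperExt.delta` for the hyper-Ext from the constant sheaf `ℤ`, i.e.
Zariski hypercohomology `Crystalline.SheafHypercohomology`), and the assertion is:

  **every `δ` has torsion image** (`∀ x, ∃ m ≠ 0, m • δ x = 0`).

Dictionary (standard, e.g. Deligne 1971 (Hodge II) §1.3 on filtered complexes / Weibel §5.4–5.5): for
the decreasing Hodge filtration `Fᵃ = σ≥a Ω•` one has `σ≤n Ω• = Ω•/F^{n+1}` and
`Ωⁿ¹[−n₁] = F^{n₁}/F^{n₁+1}`, so the sequences above are `0 → F^{n₁}/F^{n₁+1} → Ω•/F^{n₁+1} → Ω•/F^{n₁} → 0`;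
all their connecting maps vanish ⟺ all `ℍ(Ω•/F^{a+1}) → ℍ(Ω•/F^{a})` are onto ⟺ all
`ℍ(Fᵃ) → ℍ(Ω•)` are injective ⟺ the spectral sequence of the filtered complex degenerates at `E₁`;
and after the exact functor `⊗_ℤ ℚ` (`W ⊗ ℚ = K`), "`δ ⊗ ℚ = 0`" is "`δ` has torsion image".

Hypothesis: the tree's `Motives.WittScheme.IsSmoothProperModel d 𝒳` (smooth of relative dimension
`d` and proper over `W(k)`, with smooth projective geometrically irreducible fibres) — a special case of
"smooth and proper over `W`". NOT asserted: torsion-freeness of `H^b(𝒳, Ωᵃ)` (false in general), the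
integral range of Faltings / Fontaine–Messing, the relative version over a general base.
-- TODO(general form): `f : X → S` proper smooth, `S` any ℚ-scheme (Deligne 1968 Thm. 5.5 as printed).
-/

noncomputable section

-- `HasHyperExt` for the `ℤ`-extended de Rham complex and its truncations is found through
-- `IsStrictlyGE 0 ⇒ IsGE 0` and the shift/localization instances; the default budget is too small.
set_option synthInstance.maxHeartbeats 200000

namespace Literature.AlgebraicGeometry.Crystalline

open CategoryTheory AlgebraicGeometry Limits TopologicalSpace
open Literature.AlgebraicGeometry.Motives Literature.AlgebraicGeometry.Motives.WittScheme
open Literature.Algebra.Homology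

/-- **Degeneration of the Hodge–de Rham spectral sequence modulo torsion** for a smooth proper
`𝒳/W(k)`: every connecting homomorphism
`δ : ℍ^{k₀}(𝒳, σ≤n₀ Ω•_{𝒳/W}) → ℍ^{k₀+1}(𝒳, Ω^{n₀+1}_{𝒳/W}[−n₀−1])` of the stupid (Hodge) filtration of
the algebraic de Rham complex (hypercohomology = hyper-Ext from the constant sheaf `ℤ` on `|𝒳|`) has
torsion image, i.e. vanishes after `⊗ ℚ` — Deligne's `E₁`-degeneration for the generic fibre
`X_K/K` (char `0`) transported by flat base change `W → K` (see the module docstring for the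
dictionary with the spectral sequence and for the integral refinements of Faltings /
Fontaine–Messing). A named fact: its proof (Hodge theory, or Deligne–Illusie) has no carrier in the
tree. [cite: Deligne1968, Thm. 5.5 (ii)] -/
def HodgeDeRhamDegeneratesModTorsion : Prop :=
  ∀ (p : ℕ) [Fact p.Prime] (k : Type) [Field k] [CharP k p] (d : ℕ) (𝒳 : SchemeOver (WittVector p k)),
    IsSmoothProperModel d 𝒳 →
    ∀ (n₀ n₁ : ℤ) (h : n₀ + 1 = n₁) (k₀ k₁ : ℤ) (hk : k₀ + 1 = k₁),
      letI K : CochainComplex (Sheaf (Opens.grothendieckTopology 𝒳.left.carrier) AddCommGrpCat.{0}) ℤ :=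
        (algebraicDeRhamComplex 𝒳).extend ComplexShape.embeddingUpNat
      letI Z : Sheaf (Opens.grothendieckTopology 𝒳.left.carrier) AddCommGrpCat.{0} :=
        (constantSheaf (Opens.grothendieckTopology 𝒳.left.carrier) AddCommGrpCat.{0}).obj
          (AddCommGrpCat.of (ULift.{0} ℤ))
      letI S : ShortComplex (CochainComplex (Sheaf (Opens.grothendieckTopology 𝒳.left.carrier)
          AddCommGrpCat.{0}) ℤ) := stupidFiltrationShortComplex K n₀ n₁ h
      haveI : (S.X₁).IsStrictlyGE n₁ :=
        (inferInstance : ((CochainComplex.singleFunctor _ n₁).obj (K.X n₁)).IsStrictlyGE n₁)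
      haveI : HasHyperExt.{0} Z S.X₁ := hasHyperExt_of_isGE _ _ n₁
      haveI : HasHyperExt.{0} Z S.X₂ := (inferInstance : HasHyperExt.{0} Z (stupidTruncLE K n₁))
      haveI : HasHyperExt.{0} Z S.X₃ := (inferInstance : HasHyperExt.{0} Z (stupidTruncLE K n₀))
      ∀ x : HyperExt.{0} Z S.X₃ k₀,
        ∃ m : ℤ, m ≠ 0 ∧
          m • HyperExt.delta (shortExact_stupidFiltrationShortComplex K n₀ n₁ h) k₀ k₁ hk x = 0

end Literature.AlgebraicGeometry.Crystalline

end
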